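import Summits.HodgeConjecture.HodgeConjecture.Theorems.Q8SymplecticPowersQuaternionicInvariantsMatching
import Summits.HodgeConjecture.HodgeConjecture.Theorems.Q8SymplecticPowersProjectedMatchingClassesAlgebraic
import Summits.HodgeConjecture.HodgeConjecture.Theorems.Q8SymplecticPowersBlockExtension
import Summits.HodgeConjecture.HodgeConjecture.Theorems.Q8SymplecticPowersDeckIsometry
import Literature.AlgebraicGeometry.HodgeTheory.BettiUniverseTracePairing
import Literature.AlgebraicGeometry.HodgeTheory.BettiOneHodgeStructureModelIndependence
import Literature.AlgebraicGeometry.HodgeTheory.HodgeConjecture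
import HarnessLib

/-!
# Route `Q8SymplecticPowers`, crux K2Q `PowersHodgeOfQuaternionCommutators` (stmt-HodgeConjecture-24191) — the registered
# stub **`stub_higherPowersQ`** (all fibre powers `X^{k+1}`, `k ≥ 2`) BY NAME AND SIGNATURE

Prover seat `hodge-nonav-20241-p1` (g21), programme F-Q.  The registered birth skeleton
`Cruxes/PowersHodgeOfQuaternionCommutators/Lines/birth.lean` (sha16 `c8972cf19c5fdbbf`) has three stubs; the degree-2 engine
(`Q8SymplecticPowersStubDegreeTwoCore`) and the square case `stub_squareQ` (`Q8SymplecticPowersSquare`) are landed; this file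
proves the third, `stub_higherPowersQ`, with the registered signature verbatim (the `k ≤ 1` hypothesis is not used: the
argument below works for every `k`).

Proof (route A's Künneth–FFT pattern, `CyclicUnitaryPowersPowersHodgeOfDeckCommutators`, with the symplectic-quaternionic
first fundamental theorem in place of the unitary one).  A rational Hodge class of `Y = X^{k+1}` is a sum of Künneth summands
(`exists_eq_sum_fanKunnethMap_powInsert_of_mem_hodgeClasses`), each in the span of decorated Künneth insertions `E t` of HODGE
tensors `t ∈ T^{r,0}H²(X; ℚ)` (KS-Q, `Q8SymplecticPowersSummandHodgeNormalForm`, `b₁ = 0`).  With `N = Hdg¹(H²X)`,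
`T = N^{⊥ψ}` the transcendental part (C-Q: `H² = N ⊕ T`, `N ⊥_{tr∘cup} T`, `τ^*, j^*` preserve `T`, are `tr∘cup`-isometries
— `Q8SymplecticPowersDeckIsometry` — and quaternionic on `T`), every block extension `id_N ⊕ k` of a `tr∘cup|_T`-isometry `k`
of `T` commuting with `τ^*|_T, j^*|_T` lies in `Uni` (`blockExtend_uni`), so by `Comm` the commutators `id_N ⊕ [k₁, k₂]` lie in
the Hodge group and fix the Hodge tensor `t`; brick F2c-2 (`mem_span_matching_of_commutator_invariant`: block slices, Cayley
ascent ASC-Q, the quaternionic tensor FFT F1, descent, reassembly) puts `t` in the `ℚ`-span of the quaternionic matching tensors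
with free slots, and brick A-Q′ (`projectedMatchingClassesAlgebraic`: `T`-projected graph Casimirs of `𝟙, τ, j, τ ≫ j` and
Hodge-class free slots, Lefschetz `(1,1)`, Fulton's pull-back theorem) makes their insertions algebraic.

HONEST FRAMING: axioms standard; this file discharges ONE registered stub of the K2Q skeleton; the crux item 24191 closes only
when the gate credits the composition; nothing here says HC ∕ HC_CM ∕ HC_AV is proved.

## References

* R. Goodman, N. Wallach, *Symmetry, Representations, and Invariants*, GTM 255, §5.3.2 Thm. 5.3.3, §4.2.2 Prop. 4.2.5.
  [cite: GoodmanWallachGTM255]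
* C. Voisin, *Hodge Theory and Complex Algebraic Geometry I* (2002), §11.3.3 Thm. 11.38–11.41, Thm. 11.30. [cite: VoisinHodgeI2002]
* D. Huybrechts, *Lectures on K3 Surfaces* (2016), Ch. 3 Lemma 3.1, Cor. 3.4. [cite: Huybrechts2016K3]
-/

set_option linter.dupNamespace false

noncomputable section

open CategoryTheory CategoryTheory.Limits MonoidalCategory CartesianMonoidalCategory Module
open Literature.AlgebraicGeometry.Motives Literature.AlgebraicGeometry.HodgeTheory
open Literature.AlgebraicGeometry.HodgeTheory.BettiUniverse
open Literature.AlgebraicGeometry.Motives.HodgeStructure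
open Literature.AlgebraicTopology.SingularHomology
open Literature.RepresentationTheory.ClassicalInvariants (basisMonomial)
open Summit.HodgeConjecture.HodgeConjecture.Theorems.Q8SymplecticPowersTranscendentalPart
open Summit.HodgeConjecture.HodgeConjecture.Theorems.Q8SymplecticPowersTranscendentalOrthogonal
open Summit.HodgeConjecture.HodgeConjecture.Theorems.Q8SymplecticPowersBlockExtension
open Summit.HodgeConjecture.HodgeConjecture.Theorems.Q8SymplecticPowersDeckIsometry (tr_cup_pull_pull_of_pull_pow_eq_one)
open Summit.HodgeConjecture.HodgeConjecture.Theorems.Q8SymplecticPowersSummandHodgeNormalForm (summandHodgeNormalForm)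
open Summit.HodgeConjecture.HodgeConjecture.Theorems.Q8SymplecticPowersQuaternionicInvariantsMatching
  (mem_span_matching_of_commutator_invariant)
open Summit.HodgeConjecture.HodgeConjecture.Theorems.Q8SymplecticPowersProjectedMatchingClassesAlgebraic
  (projectedMatchingClassesAlgebraic)
open scoped TensorProduct PiTensorProduct BigOperators Matrix

namespace Summit.HodgeConjecture.HodgeConjecture.Theorems.Q8SymplecticPowersStubHigherPowersQ

variable {X : SchemeOver ℂ}

/-- **All fibre powers**: for a smooth projective surface `X` with `b₁ = 0`, a cohomological quaternion deck pair `τ, j`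
(`τ^{*4} = 1`, `j^{*2} = τ^{*2}`, `j^*τ^* = τ^{*3}j^*`, no `τ^{*2}`-invariant and some anti-invariant `(2,0)`-form) and the
route's `Comm` clause, the Hodge conjecture holds for every limit fan `Y` of `k + 1` copies of `X`.
[cite: GoodmanWallachGTM255, §5.3.2 Thm. 5.3.3] [cite: VoisinHodgeI2002, §11.3.3 Thm. 11.38–11.41 and Thm. 11.30] -/
theorem powersHodge (hX : IsSmoothProjective 2 X) (hb1 : Module.finrank ℚ (bettiCohomology X 1) = 0) (τ j : X ⟶ X)
    (h4 : pull τ 2 ^ 4 = 1) (hj : pull j 2 ^ 2 = pull τ 2 ^ 2) (hrel : pull j 2 * pull τ 2 = pull τ 2 ^ 3 * pull j 2)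
    (h20 : Module.finrank ℂ ↥(Module.End.eigenspace ((pull τ 2 ^ 2).baseChange ℂ) 1 ⊓
      (hodge exists_isReal_hodgeModel_holds hX 2).piece 2 0) = 0)
    (hpos : 0 < Module.finrank ℂ ↥(Module.End.eigenspace ((pull τ 2 ^ 2).baseChange ℂ) (-1) ⊓
      (hodge exists_isReal_hodgeModel_holds hX 2).piece 2 0))
    (hComm : haveI := finite hX 2; haveI : HodgeTensorFacts.{0, 0} := hodgeTensorFacts_holds;
      ∀ g h : bettiCohomology X 2 ≃ₗ[ℚ] bettiCohomology X 2,
        ((∀ x, g (pull τ 2 x) = pull τ 2 (g x)) ∧ (∀ x, g (pull j 2 x) = pull j 2 (g x)) ∧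
          (∀ x y, tr hX (2 + 2) (cup X 2 2 (g x) (g y)) = tr hX (2 + 2) (cup X 2 2 x y)) ∧
          ∀ x ∈ (hodge exists_isReal_hodgeModel_holds hX 2).hodgeClasses 1, g x = x) →
        ((∀ x, h (pull τ 2 x) = pull τ 2 (h x)) ∧ (∀ x, h (pull j 2 x) = pull j 2 (h x)) ∧
          (∀ x y, tr hX (2 + 2) (cup X 2 2 (h x) (h y)) = tr hX (2 + 2) (cup X 2 2 x y)) ∧
          ∀ x ∈ (hodge exists_isReal_hodgeModel_holds hX 2).hodgeClasses 1, h x = x) →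
        g * h * g⁻¹ * h⁻¹ ∈ (hodge exists_isReal_hodgeModel_holds hX 2).hodgeGroup)
    {k : ℕ} {Y : SchemeOver ℂ} (π : Fin (k + 1) → (Y ⟶ X)) (hlim : IsLimit (Fan.mk Y π)) :
    HodgeConjectureFor (2 * (k + 1)) Y := by
  classical
  haveI hfin : Module.Finite ℚ (bettiCohomology X 2) := finite hX 2
  haveI hTF : HodgeTensorFacts.{0, 0} := hodgeTensorFacts_holds
  have hYsp : IsSmoothProjective (2 * (k + 1)) Y := isSmoothProjective_of_isLimit_fan hX π hlim
  -- ### the transcendental data `(N, T, Q, a, b)` of `H²(X; ℚ)`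
  set H := hodge exists_isReal_hodgeModel_holds hX 2 with hH
  obtain ⟨ψ⟩ := hodge_isPolarizable exists_isReal_hodgeModel_holds hX 2
  have h11 : (1 : ℤ) + 1 = ((2 : ℕ) : ℤ) := by norm_num
  set N : Submodule ℚ (bettiCohomology X 2) := H.hodgeClasses 1 with hN
  set T : Submodule ℚ (bettiCohomology X 2) := ψ.form.orthogonal (H.hodgeClasses 1) with hT
  have hc : IsCompl N T := ψ.isCompl_hodgeClasses_orthogonal h11
  set Q : LinearMap.BilinForm ℚ (bettiCohomology X 2) := (cup X 2 2).compr₂ (tr hX (2 + 2)) with hQdef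
  have hQ : ∀ x y, Q x y = tr hX (2 + 2) (cup X 2 2 x y) := fun x y => rfl
  have hQs : ∀ x y, Q x y = Q y x := fun x y => by
    rw [hQ, hQ]
    have h := bettiCup_gradedComm (cupProduct_gradedComm_holds ℚ (ComplexPoints X)) (rfl : 2 + 2 = 2 + 2) rfl x y
    have h1 : ((-1 : ℚ) ^ (2 * 2)) = 1 := by norm_num
    rw [h1, one_smul] at h
    exact congrArg _ h
  have haT : ∀ x ∈ T, pull τ 2 x ∈ T := fun x hx => pull_mem_transcendental hX ψ τ hx
  have hbT : ∀ x ∈ T, pull j 2 x ∈ T := fun x hx => pull_mem_transcendental hX ψ j hx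
  have horth : ∀ n ∈ N, ∀ t ∈ T, tr hX (2 + 2) (cup X 2 2 n t) = 0 := fun n hn t ht =>
    tr_cup_eq_zero_of_mem_hodgeClasses_of_mem_orthogonal hX ψ hn ht
  have horth' : ∀ t ∈ T, ∀ n ∈ N, tr hX (2 + 2) (cup X 2 2 t n) = 0 := fun t ht n hn =>
    tr_cup_eq_zero_of_mem_orthogonal_hodgeClasses hX ψ ht hn
  -- nondegeneracy of `Q` on `N` and on `T`
  have hsepT : ∀ x : T, (∀ y : T, Q x y = 0) → x = 0 := by
    intro x hx
    have hall : ∀ v : bettiCohomology X 2, tr hX (2 + 2) (cup X 2 2 (x : bettiCohomology X 2) v) = 0 := by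
      intro v
      obtain ⟨n, t, rfl⟩ := exists_eq_add hc v
      rw [map_add, map_add, horth' _ x.2 _ n.2, zero_add, ← hQ, hx t]
    exact Subtype.ext ((nondegenerate_tr_cup hX).1 (x : bettiCohomology X 2) fun v => by
      rw [LinearMap.compr₂_apply]; exact hall v)
  have hsepN : ∀ x : N, (∀ y : N, Q x y = 0) → x = 0 := by
    intro x hx
    have hall : ∀ v : bettiCohomology X 2, tr hX (2 + 2) (cup X 2 2 (x : bettiCohomology X 2) v) = 0 := by
      intro v
      obtain ⟨n, t, rfl⟩ := exists_eq_add hc v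
      rw [map_add, map_add, horth _ x.2 _ t.2, add_zero, ← hQ, hx n]
    exact Subtype.ext ((nondegenerate_tr_cup hX).1 (x : bettiCohomology X 2) fun v => by
      rw [LinearMap.compr₂_apply]; exact hall v)
  have hQT : (Q.restrict T).Nondegenerate := by
    refine ⟨fun x hx => hsepT x fun y => hx y, fun y hy => hsepT y fun x => ?_⟩
    show Q y x = 0
    rw [hQs]; exact hy x
  have hQN : (Q.restrict N).Nondegenerate := by
    refine ⟨fun x hx => hsepN x fun y => hx y, fun y hy => hsepN y fun x => ?_⟩
    show Q y x = 0
    rw [hQs]; exact hy x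
  -- quaternion relations and isometries on `T`
  obtain ⟨hτ2, hj2, hτj⟩ := quaternion_relations_on_transcendental hX ψ τ j h4 hj hrel h20
  have hpg : H.piece 2 0 ≠ ⊥ := by
    intro hbot
    rw [hH] at hbot
    rw [hbot, inf_bot_eq, finrank_bot] at hpos
    exact lt_irrefl _ hpos
  have hj4 : pull j 2 ^ 4 = 1 := by rw [show (4 : ℕ) = 2 * 2 from rfl, pow_mul, hj, ← pow_mul]; exact h4
  have haQ : ∀ x ∈ T, ∀ y ∈ T, Q (pull τ 2 x) (pull τ 2 y) = Q x y := fun x _ y _ =>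
    tr_cup_pull_pull_of_pull_pow_eq_one hX τ (by norm_num : 0 < 4) h4 hpg x y
  have hbQ : ∀ x ∈ T, ∀ y ∈ T, Q (pull j 2 x) (pull j 2 y) = Q x y := fun x _ y _ =>
    tr_cup_pull_pull_of_pull_pow_eq_one hX j (by norm_num : 0 < 4) hj4 hpg x y
  -- bases
  set bN : Module.Basis (Fin (Module.finrank ℚ N)) ℚ N := Module.finBasis ℚ N with hbN
  set bT : Module.Basis (Fin (Module.finrank ℚ T)) ℚ T := Module.finBasis ℚ T with hbT'
  set bV := Module.finBasis ℚ (bettiCohomology X 2) with hbV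
  have hGN : IsUnit (Matrix.of fun k k' : Fin (Module.finrank ℚ N) =>
      tr hX (2 + 2) (cup X 2 2 (bN k : bettiCohomology X 2) (bN k'))).det := by
    have h := (LinearMap.BilinForm.nondegenerate_iff_det_ne_zero bN).1 hQN
    rw [Literature.RepresentationTheory.ClassicalInvariants.toMatrix_eq_of] at h
    exact isUnit_iff_ne_zero.2 h
  have hGT : IsUnit (Matrix.of fun k k' : Fin (Module.finrank ℚ T) =>
      tr hX (2 + 2) (cup X 2 2 (bT k : bettiCohomology X 2) (bT k'))).det := by
    have h := (LinearMap.BilinForm.nondegenerate_iff_det_ne_zero bT).1 hQT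
    rw [Literature.RepresentationTheory.ClassicalInvariants.toMatrix_eq_of] at h
    exact isUnit_iff_ne_zero.2 h
  -- the four self-maps `𝟙, τ, j, τ ≫ j` and their matrices on `T`
  set σs : Fin 4 → (X ⟶ X) := ![𝟙 X, τ, j, τ ≫ j] with hσs
  have hσT : ∀ d, ∀ x ∈ T, pull (σs d) 2 x ∈ T := fun d x hx => pull_mem_transcendental hX ψ (σs d) hx
  have hD : ∀ d, (![(1 : Matrix (Fin (Module.finrank ℚ T)) (Fin (Module.finrank ℚ T)) ℚ),
      LinearMap.toMatrix bT bT ((pull τ 2).restrict haT), LinearMap.toMatrix bT bT ((pull j 2).restrict hbT),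
      LinearMap.toMatrix bT bT ((pull τ 2).restrict haT) * LinearMap.toMatrix bT bT ((pull j 2).restrict hbT)] : Fin 4 → _) d =
      LinearMap.toMatrix bT bT ((pull (σs d) 2).restrict (hσT d)) := by
    intro d
    fin_cases d
    · rw [← LinearMap.toMatrix_id (v₁ := bT)]
      simp only [Matrix.cons_val_zero, Fin.zero_eta]
      congr 1
      refine LinearMap.ext fun x => Subtype.ext ?_
      rw [LinearMap.id_apply, LinearMap.coe_restrict_apply]
      show (x : bettiCohomology X 2) = pull (𝟙 X) 2 x
      rw [pull_id, LinearMap.id_apply]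
    · rfl
    · rfl
    · simp only [Fin.reduceFinMk, Matrix.cons_val]
      rw [← LinearMap.toMatrix_mul]
      congr 1
      refine LinearMap.ext fun x => Subtype.ext ?_
      rw [Module.End.mul_apply, LinearMap.coe_restrict_apply, LinearMap.coe_restrict_apply, LinearMap.coe_restrict_apply]
      show pull τ 2 (pull j 2 (x : bettiCohomology X 2)) = pull (τ ≫ j) 2 x
      rw [pull_comp τ j 2, LinearMap.comp_apply]
  -- ### the Hodge conjecture for `Y`
  refine ⟨⟨realHodgeModel exists_isReal_hodgeModel_holds hYsp⟩, ?_⟩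
  intro q c hrat hqq
  obtain ⟨v, rfl⟩ := (isRationalClass_iff_mem_range_ofRatClass c).1 hrat
  have hv : v ∈ (hodge exists_isReal_hodgeModel_holds hYsp (2 * q)).hodgeClasses q :=
    (HodgeModel.mem_hodgeClasses_iff_isOfHodgeType (realHodgeModel exists_isReal_hodgeModel_holds hYsp) hYsp
      hodgePQ_independent_of_hodgeModel_holds (realHodgeModel_isHodgeSymmetric exists_isReal_hodgeModel_holds hYsp)
      q v).2 hqq
  -- Künneth–Hodge: `v` is a sum over the tensor summands of Künneth images of summand Hodge classes
  obtain ⟨xκ, hxκ, rfl⟩ := exists_eq_sum_fanKunnethMap_powInsert_of_mem_hodgeClasses exists_isReal_hodgeModel_holds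
    hodgePQ_independent_of_hodgeModel_holds hX π hlim hYsp (q : ℤ) hv
  rw [map_sum]
  refine Submodule.sum_mem _ fun κ _ => ?_
  -- each summand lies in the span of the decorated Künneth insertions `E t` of Hodge tensors (KS-Q)
  have hspan := summandHodgeNormalForm hX hb1 π hlim q κ (xκ κ) (hxκ κ)
  refine Submodule.span_induction (p := fun x _ => ofRatClass (ComplexPoints Y) (2 * q) x ∈ algebraicClasses Y q)
    ?_ ?_ ?_ ?_ hspan
  · rintro x ⟨q', r, u, wdec, hwdec, E, hE, t, ht, rfl⟩
    -- the Hodge tensor `t` is fixed by `id_N ⊕ [k₁, k₂]` for `k₁, k₂` in the quaternionic-unitary centraliser of `T`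
    have hinv : ∀ k₁ k₂ : T ≃ₗ[ℚ] T,
        (∀ x : T, (k₁ ((pull τ 2).restrict haT x) : bettiCohomology X 2) = pull τ 2 (k₁ x)) →
        (∀ x : T, (k₁ ((pull j 2).restrict hbT x) : bettiCohomology X 2) = pull j 2 (k₁ x)) →
        (∀ x y : T, Q (k₁ x) (k₁ y) = Q x y) →
        (∀ x : T, (k₂ ((pull τ 2).restrict haT x) : bettiCohomology X 2) = pull τ 2 (k₂ x)) →
        (∀ x : T, (k₂ ((pull j 2).restrict hbT x) : bettiCohomology X 2) = pull j 2 (k₂ x)) →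
        (∀ x y : T, Q (k₂ x) (k₂ y) = Q x y) →
        tensorSpaceAct (blockExtend hc (k₁ * k₂ * k₁⁻¹ * k₂⁻¹)) t = t := by
      intro k₁ k₂ h1a h1b h1Q h2a h2b h2Q
      obtain ⟨p', hp', ht'⟩ := ht
      have hu1 := blockExtend_uni hX ψ (T := T) rfl hc τ j k₁ (fun x => h1a x) (fun x => h1b x) (fun x y => h1Q x y)
      have hu2 := blockExtend_uni hX ψ (T := T) rfl hc τ j k₂ (fun x => h2a x) (fun x => h2b x) (fun x y => h2Q x y)
      have hmem := hComm _ _ hu1 hu2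
      rw [← blockExtend_commutator] at hmem
      exact (HodgeStructure.mem_hodgeGroup_iff _ _).1 hmem r 0 p' hp' t ht'
    -- F2c-2: `t` is a combination of quaternionic matching tensors with free slots
    have htspan := mem_span_matching_of_commutator_invariant Q hQs (pull τ 2) (pull j 2) hc haT hbT hQT hτ2 hj2 hτj haQ hbQ
      bN bT bV r t hinv
    refine Submodule.span_induction
      (p := fun y _ => ofRatClass (ComplexPoints Y) (2 * q) (E y) ∈ algebraicClasses Y q) ?_ ?_ ?_ ?_ htspan
    · rintro m ⟨jj, l, ε, δ, z, hz, rfl⟩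
      -- A-Q′: the insertion of a quaternionic matching tensor is algebraic
      simp only [hD]
      exact projectedMatchingClassesAlgebraic hX hb1 π hlim q q' r u wdec hwdec E hE hc (fun x hx => hx) horth horth' bN bT
        hGN hGT jj l ε (fun c' => σs (δ c')) (fun c' => hσT (δ c')) z hz
    · simp
    · intro a b _ _ ha hb
      simpa [map_add] using add_mem ha hb
    · intro a y _ hy
      simpa [map_smul, Literature.AlgebraicGeometry.Motives.ofRatClass_smul] using Submodule.smul_mem _ (a : ℂ) hy
  · simp
  · intro a b _ _ ha hb
    simpa [map_add] using add_mem ha hb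
  · intro a y _ hy
    simpa [Literature.AlgebraicGeometry.Motives.ofRatClass_smul] using Submodule.smul_mem _ (a : ℂ) hy

/-- **`stub_higherPowersQ`** (K2Q birth skeleton, registered signature verbatim): the `k ≥ 2` fibre powers, from
`powersHodge` (the `k ≤ 1` hypothesis is not needed). [cite: GoodmanWallachGTM255, §5.3.2 Thm. 5.3.3]
[cite: VoisinHodgeI2002, §11.3.3 Thm. 11.38–11.41] -/
theorem stub_higherPowersQ :
    open Literature.AlgebraicGeometry.Motives Literature.AlgebraicGeometry.HodgeTheory Literature.AlgebraicGeometry.HodgeTheory.BettiUniverse CategoryTheory.Limits in let Uni : (X : SchemeOver ℂ) → IsSmoothProjective 2 X → (X ⟶ X) → (X ⟶ X) → (bettiCohomology X 2 ≃ₗ[ℚ] bettiCohomology X 2) → Prop := fun X hX τ j g => (∀ x, g (pull τ 2 x) = pull τ 2 (g x)) ∧ (∀ x, g (pull j 2 x) = pull j 2 (g x)) ∧ (∀ x y, tr hX (2 + 2) (cup X 2 2 (g x) (g y)) = tr hX (2 + 2) (cup X 2 2 x y)) ∧ ∀ x ∈ (hodge exists_isReal_hodgeModel_holds hX 2).hodgeClasses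 1, g x = x; let Comm : (X : SchemeOver ℂ) → IsSmoothProjective 2 X → (X ⟶ X) → (X ⟶ X) → Prop := fun X hX τ j => haveI := finite hX 2; haveI : HodgeTensorFacts.{0, 0} := hodgeTensorFacts_holds; ∀ g h : bettiCohomology X 2 ≃ₗ[ℚ] bettiCohomology X 2, Uni X hX τ j g → Uni X hX τ j h → g * h * g⁻¹ * h⁻¹ ∈ (hodge exists_isReal_hodgeModel_holds hX 2).hodgeGroup; ∀ ⦃X : SchemeOver ℂ⦄ (hX : IsSmoothProjective 2 X), Module.finrank ℚ (bettiCohomology X 1) = 0 → ∀ τ j : X ⟶ X, (pull τ 2 ^ 4 = 1 ∧ pull j 2 ^ 2 = pull τ 2 ^ 2 ∧ pull j 2 * pull τ 2 = pull τ 2 ^ 3 * pull j 2 ∧ Module.finrank ℂ ↥(Module.End.eigenspace ((pull τ 2 ^ 2).baseChange ℂ) 1 ⊓ (hodge exists_isReal_hodgeModel_holds hX 2).piece 2 0) = 0 ∧ 0 < Module.finrank ℂ ↥(Module.End.eigenspace ((pull τ 2 ^ 2).baseChange ℂ) (-1) ⊓ (hodge exists_isReal_hodgeModel_holds hX 2).piece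 2 0)) → Comm X hX τ j → (∀ ⦃k : ℕ⦄ ⦃Y : SchemeOver ℂ⦄, k ≤ 1 → (∃ π : Fin (k + 1) → (Y ⟶ X), Nonempty (IsLimit (Fan.mk Y π))) → HodgeConjectureFor (2 * (k + 1)) Y) → ∀ ⦃k : ℕ⦄ ⦃Y : SchemeOver ℂ⦄, 2 ≤ k → (∃ π : Fin (k + 1) → (Y ⟶ X), Nonempty (IsLimit (Fan.mk Y π))) → HodgeConjectureFor (2 * (k + 1)) Y := by
  intro Uni Comm X hX hb1 τ j hdeck hcomm _ k Y _ hY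
  obtain ⟨π, ⟨hlim⟩⟩ := hY
  exact powersHodge hX hb1 τ j hdeck.1 hdeck.2.1 hdeck.2.2.1 hdeck.2.2.2.1 hdeck.2.2.2.2 hcomm π hlim

end Summit.HodgeConjecture.HodgeConjecture.Theorems.Q8SymplecticPowersStubHigherPowersQ

end
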